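import Summits.HodgeConjecture.HodgeConjecture.Theorems.Ring2WeilCoverageWeilGramLevel60SqrtNegOne
import Summits.HodgeConjecture.HodgeConjecture.Theorems.Ring2WeilCoverageWeilGramLevel60SqrtNegThree
import Summits.HodgeConjecture.HodgeConjecture.Theorems.Ring2WeilCoverageWeilGramLevel60SqrtNegFive
import Summits.HodgeConjecture.HodgeConjecture.Theorems.Ring2WeilCoverageWeilGramLevel60SqrtNegFifteen
import Summits.HodgeConjecture.HodgeConjecture.Theorems.Ring2WeilCoverageWeilGramSign
import Summits.HodgeConjecture.HodgeConjecture.Theorems.Ring2WeilCoverageCyclotomicSignaturesG8B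
import Summits.HodgeConjecture.HodgeConjecture.Theorems.Ring2WeilCoverageRealUnitNormTwelve
import HarnessLib

/-!
# Weil-type family coverage — THE COMPONENTS OF THE WEIL-TYPE `ℤ[ζ₆₀]`-EIGHTFOLDS, VI: `θ^i` (`i < 8`) is a `ℚ`-basis of
# `ℚ(ζ₆₀)⁺`; for each of the 4 imaginary quadratic `K_d ⊂ ℚ(ζ₆₀)` EVERY principal-type `E_ζ′` has the Gram determinant
# of §1 of parts 172–175 (`ℚ(i)`: `256`; `ℚ(√−3)`: `20736`; `ℚ(√−5)`: `160000`; `ℚ(√−15)`: `12960000`) — all of the RIGHT sign and in the SPLIT class: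
# **the principally polarised Weil-type `ℤ[ζ₆₀]`-CM eightfolds lie on the SPLIT rows `W8.d.1`, for every `K_d`-balanced CM type**

research route conditional on HC_CM; not a corollary; Q11.4-sentence-2 already refuted in dim ≥ 3.

Ring 2, WEIL-TYPE FAMILY-COVERAGE CENSUS (`HOME/WEIL-FAMILY-COVERAGE.md` `## b01`, blocks b01.36 (D) (the YES rows at `60`),
b01.47–b01.49; owner ring2-b01), part 176 of the `Ring2WeilCoverage*` series; continues parts 172–175 (traces,
Hankel matrices, determinants).
At the level `M = 60` (`g = 8`, `h(ℚ(ζ₆₀)) = 1`) EVERY census row `(60, K_d)` is a YES row (an `ι`-compatible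
PRINCIPAL polarisation exists on every `K_d`-balanced `ℂ^Φ/Φ(ℤ[ζ₆₀])`, b01.36 / parts 14–22); this series computes, for each
`K_d ⊂ ℚ(ζ₆₀)`, van Geemen's Gram determinant of the principal type in the real frame `θ^i` and places these CM points on
their component: the SPLIT row `W8.d.1` — completing the census's component column at every `h = 1` level (b01.47–b01.49
did `15, 16, 20, 24 / 21, 28, 36 / 33, 44 / 35, 45`).

* §2 `[ℚ(ζ₆₀)⁺ : ℚ] = 8` and **`1, θ, …, θ⁷` is a `ℚ`-basis of `ℚ(ζ₆₀)⁺`** (a relation traced against `ξ s θ^m` lies in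
  the kernel of the non-singular Gram matrix).
* `K_d = ℚ(i)` (`s = √−1 = ζ¹⁵ = i`): **EVERY principal-type `ζ′` gives `det a = 256`** (`N(u) = 1` by THEOREM L (i) at `60`, `norm_realUnits_pos_sixty`); such `Φ`-positive `ζ′` exist on every `ℚ(i)`-balanced `Φ` (`exists_principal_sixty_sqrt_neg_one`) — CENSUS FORM; class **`[256] = [16² + 1·0²] = splitDiscriminantClass 4 1`**, SPLIT: row W8.1.1 `= (4, ℚ(i), 1)`.
* `K_d = ℚ(√−3)` (`s = √−3 = 1 + 2ζ²⁰ (ζ₃ = ζ²⁰)`): **EVERY principal-type `ζ′` gives `det a = 20736`** (`N(u) = 1` by THEOREM L (i) at `60`, `norm_realUnits_pos_sixty`); such `Φ`-positive `ζ′` exist on every `ℚ(√−3)`-balanced `Φ` (`exists_principal_sixty_sqrt_neg_three`) — CENSUS FORM; class **`[20736] = [144² + 3·0²] = splitDiscriminantClass 4 3`**, SPLIT: row W8.3.1 `= (4, ℚ(√−3), 1)`.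
* `K_d = ℚ(√−5)` (`s = √−5 = ζ¹⁵·(1 + 2(ζ¹² + ζ⁴⁸)) = i·√5 (Gauss sum of ζ₅ = ζ¹²)`): **EVERY principal-type `ζ′` gives `det a = 160000`** (`N(u) = 1` by THEOREM L (i) at `60`, `norm_realUnits_pos_sixty`); such `Φ`-positive `ζ′` exist on every `ℚ(√−5)`-balanced `Φ` (`exists_principal_sixty_sqrt_neg_five`) — CENSUS FORM; class **`[160000] = [400² + 5·0²] = splitDiscriminantClass 4 5`**, SPLIT: row W8.5.1 `= (4, ℚ(√−5), 1)`.
* `K_d = ℚ(√−15)` (`s = √−15 = (1 + 2ζ²⁰)(1 + 2(ζ¹² + ζ⁴⁸)) = √−3·√5`): **EVERY principal-type `ζ′` gives `det a = 12960000`** (`N(u) = 1` by THEOREM L (i) at `60`, `norm_realUnits_pos_sixty`); such `Φ`-positive `ζ′` exist on every `ℚ(√−15)`-balanced `Φ` (`exists_principal_sixty_sqrt_neg_fifteen`) — CENSUS FORM; class **`[12960000] = [3600² + 15·0²] = splitDiscriminantClass 4 15`**, SPLIT: row W8.15.1 `= (4, ℚ(√−15), 1)`.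

HONEST FRAMING as parts 82–154: kernel statements about traces in `ℚ(ζ₆₀)`, Shimura's divisors of principal type on
`ℂ^Φ/Φ(ℤ[ζ₆₀])` and norm classes; the census ROW words are the reading of the class `[det a]` by [vG94 Lemma 5.2 (3),
(5.4.1)]; nothing about Hodge classes, `W_K`, general members or HC; `HC_CM` is used nowhere.  No `def`, no named fact,
no `sorry`.

References: [cite: vanGeemen1994HodgeAV, Lemma 5.2 (2)–(4), 5.4 and (5.4.1)]; [cite: Shimura1998, §14.3 Prop. 4–5,
pp. 103–104]; census b01.36 (D), b01.47–b01.49 (seat-derived).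
-/

noncomputable section

open Polynomial NumberField Module
open scoped nonZeroDivisors

namespace Summit.HodgeConjecture.Ring2WeilCoverage.WeilGramLevel60Principal

open Literature.AlgebraicGeometry.VanGeemen1994 (weilField weilNormResidueGroup)
open Literature.AlgebraicGeometry.Motives (CMType normUnitsSubgroup)
open Literature.NumberTheory.ComplexMultiplication
open Summit.HodgeConjecture.Ring2WeilCoverage.WeilGramTools
open Summit.HodgeConjecture.Ring2WeilCoverage.WeilGramCMPoint
open Summit.HodgeConjecture.Ring2WeilCoverage.RealUnitNormHalfSystems (complexConj_eq_inv)
open Summit.HodgeConjecture.Ring2WeilCoverage.CyclotomicPrincipalObstruction (complexConj_xi)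
open Summit.HodgeConjecture.Ring2WeilCoverage.CyclotomicDifferent (isOfType_one_xi_top xi_ne_zero)
open Summit.HodgeConjecture.HodgeConjecture.Ring2.WeilCoverage (mk_neg_eq_split_of_odd mk_neg_ne_split_of_odd
  mk_eq_split_of_even mk_ne_split_of_even mem_normUnitsSubgroup_of_sq_add_mul_sq natCast_not_mem_normUnitsSubgroup_of_ramified)
open Summit.HodgeConjecture.HodgeConjecture.Ring2.Hypotheses (splitDiscriminantClass)
open Summit.HodgeConjecture.Ring2WeilCoverage.WeilGramLevel60
open Summit.HodgeConjecture.Ring2WeilCoverage.WeilGramLevel60SqrtNegOne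
open Summit.HodgeConjecture.Ring2WeilCoverage.WeilGramLevel60SqrtNegThree
open Summit.HodgeConjecture.Ring2WeilCoverage.WeilGramLevel60SqrtNegFive
open Summit.HodgeConjecture.Ring2WeilCoverage.WeilGramLevel60SqrtNegFifteen
open Summit.HodgeConjecture.Ring2WeilCoverage.WeilGramSign (not_pos_of_neg_one_pow_mul_det_nonpos neg_one_pow_mul_det_realPart_pos)
open Summit.HodgeConjecture.Ring2WeilCoverage.RealUnitNormTwelve (norm_realUnits_pos_sixty)
open Summit.HodgeConjecture.Ring2WeilCoverage.CyclotomicSignaturesG8B (exists_principal_sixty_sqrt_neg_one exists_principal_sixty_sqrt_neg_three exists_principal_sixty_sqrt_neg_five exists_principal_sixty_sqrt_neg_fifteen)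
variable {K : Type} [Field K] [NumberField K] {ζ : K}

/-- `𝐞(t) = exp(2πi t/n) ∈ ℂ` (`ZMod.toCircle`). -/
local notation3 (prettyPrint := false) "𝐞 " t:max => ((ZMod.toCircle t : Circle) : ℂ)

/-- the residue set `S_Φ` read at level `60`. -/
local notation3 (prettyPrint := false) "SΦ[" Φ "," z "]" =>
  (Finset.univ.filter fun t : ZMod 60 => ∃ σ ∈ (Φ : CMType K).1, σ (z : K) = 𝐞 t)

/-! ### §2 `1, θ, …, θ⁷` is a `ℚ`-basis of `K⁺ = ℚ(ζ₆₀)⁺` -/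

/-- `[ℚ(ζ_60)⁺ : ℚ] = 8`. [folklore] -/
theorem finrank_realSubfield [IsCyclotomicExtension {60} ℚ K] [IsCMField K] :
    finrank ℚ (maximalRealSubfield K) = 8 := by
  have h1 : finrank ℚ K = 16 := by
    rw [IsCyclotomicExtension.finrank K (cyclotomic.irreducible_rat (by norm_num : 0 < 60))]; decide
  have h2 := Module.finrank_mul_finrank ℚ (maximalRealSubfield K) K
  rw [Algebra.IsQuadraticExtension.finrank_eq_two (maximalRealSubfield K) K, h1] at h2
  omega

/-- **`1, θ, …, θ^{8−1}` are `ℚ`-linearly independent in `K⁺`**: a relation `Σ cₖ θ^k = 0`, multiplied by `ζ′ s θ^m` and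
traced, says that `c` is in the kernel of the Gram matrix `a` of §1, whose determinant is non-zero.
research route conditional on HC_CM; not a corollary; Q11.4-sentence-2 already refuted in dim ≥ 3. [folklore] -/
theorem linearIndependent_thetaPow [IsCyclotomicExtension {60} ℚ K] [IsCMField K] (hζ : IsPrimitiveRoot ζ 60)
    {ω : Fin 8 → maximalRealSubfield K} (hω : ∀ i, (ω i : K) = (ζ + ζ⁻¹) ^ (i : ℕ)) : LinearIndependent ℚ ω := by
  rw [Fintype.linearIndependent_iff]
  intro c hc
  have hcK : ∑ i : Fin 8, (c i : K) * (ζ + ζ⁻¹) ^ (i : ℕ) = 0 := by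
    have h := congrArg (fun y : maximalRealSubfield K => (y : K)) hc
    simp only [ZeroMemClass.coe_zero] at h
    rw [← h]
    push_cast
    refine Finset.sum_congr rfl fun i _ => ?_
    rw [Rat.smul_def, hω i]
  have E : ∀ m : ℕ, ∑ i : Fin 8, c i * Algebra.trace ℚ K ((ζ ^ 7 * (aeval ζ (derivative (cyclotomic 60 ℚ)))⁻¹) * (ζ ^ 15) *
      ((ζ + ζ⁻¹) ^ m * (ζ + ζ⁻¹) ^ (i : ℕ))) = 0 := by
    intro m
    have h := congrArg (fun y => Algebra.trace ℚ K ((ζ ^ 7 * (aeval ζ (derivative (cyclotomic 60 ℚ)))⁻¹) * (ζ ^ 15) * (ζ + ζ⁻¹) ^ m * y)) hcK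
    simp only [mul_zero, map_zero, Finset.mul_sum, map_sum] at h
    rw [← h]
    refine Finset.sum_congr rfl fun i _ => ?_
    rw [show (ζ ^ 7 * (aeval ζ (derivative (cyclotomic 60 ℚ)))⁻¹) * (ζ ^ 15) * (ζ + ζ⁻¹) ^ m *
        ((c i : K) * (ζ + ζ⁻¹) ^ (i : ℕ)) = (c i) • ((ζ ^ 7 * (aeval ζ (derivative (cyclotomic 60 ℚ)))⁻¹) * (ζ ^ 15) *
        ((ζ + ζ⁻¹) ^ m * (ζ + ζ⁻¹) ^ (i : ℕ))) by rw [Rat.smul_def]; ring, map_smul, smul_eq_mul]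
  set x : Fin 8 → K := fun i => (ζ + ζ⁻¹) ^ (i : ℕ) with hxdef
  have hx : ∀ i, x i = (ζ + ζ⁻¹) ^ (i : ℕ) := fun i => rfl
  set a : Matrix (Fin 8) (Fin 8) ℚ := Matrix.of fun i j => Algebra.trace ℚ K ((ζ ^ 7 * (aeval ζ (derivative (cyclotomic 60 ℚ)))⁻¹) * x i *
      IsCMField.complexConj K ((ζ ^ 15) * x j)) with hadef
  have ha : ∀ i j, a i j = Algebra.trace ℚ K ((ζ ^ 7 * (aeval ζ (derivative (cyclotomic 60 ℚ)))⁻¹) * x i *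
      IsCMField.complexConj K ((ζ ^ 15) * x j)) := fun i j => rfl
  have hdet : a.det ≠ 0 := by
    rw [det_realPart_xi_sqrtNegOne hζ hx ha]; norm_num
  have ha2 : ∀ i j, a i j = -Algebra.trace ℚ K ((ζ ^ 7 * (aeval ζ (derivative (cyclotomic 60 ℚ)))⁻¹) * (ζ ^ 15) * (x i * x j)) :=
    fun i j => by
      have h := congrFun (congrFun (ha_eq (complexConj_sqrtNegOne hζ) (complexConj_thetaFrame hζ hx) ha) i) j
      rwa [Matrix.of_apply] at h
  have hmv : a.mulVec (fun i => c i) = 0 := by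
    funext m
    simp only [Matrix.mulVec, dotProduct, Pi.zero_apply, ha2, hx, neg_mul]
    rw [Finset.sum_neg_distrib, neg_eq_zero, ← E m]
    exact Finset.sum_congr rfl fun i _ => mul_comm _ _
  have h0 := Matrix.eq_zero_of_mulVec_eq_zero hdet hmv
  intro i
  simpa using congrFun h0 i

/-- **A `ℚ`-basis `ωb` of `K⁺ = ℚ(ζ_60)⁺` with `ωb i = θ^i`** (`i < 8`). [folklore] -/
theorem exists_basis_thetaPow [IsCyclotomicExtension {60} ℚ K] [IsCMField K] (hζ : IsPrimitiveRoot ζ 60) :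
    ∃ ωb : Basis (Fin 8) ℚ (maximalRealSubfield K), ∀ i, (ωb i : K) = (ζ + ζ⁻¹) ^ (i : ℕ) := by
  let θ' : maximalRealSubfield K :=
    ⟨ζ + ζ⁻¹, (IsCMField.complexConj_eq_self_iff K (ζ + ζ⁻¹)).mp (complexConj_theta hζ)⟩
  let ω : Fin 8 → maximalRealSubfield K := fun i => θ' ^ (i : ℕ)
  have hω : ∀ i, (ω i : K) = (ζ + ζ⁻¹) ^ (i : ℕ) := fun i => by simp [ω, θ']
  have hli := linearIndependent_thetaPow hζ hω
  have hcard : Fintype.card (Fin 8) = finrank ℚ (maximalRealSubfield K) := by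
    rw [Fintype.card_fin, finrank_realSubfield]
  exact ⟨basisOfLinearIndependentOfCardEqFinrank hli hcard, fun i => by
    rw [coe_basisOfLinearIndependentOfCardEqFinrank]; exact hω i⟩

/-! ### §3 `K_d = ℚ(i)` (`s = i`): invariance, census form, class SPLIT (row W8.1.1) -/

/-- **For EVERY skew `ζ′` of PRINCIPAL type on `ℤ[ζ_60]` (`IsOfType 1 ζ′ ⊤`; `ζ′ = uξ`, `u` a real unit, `N(u) = 1`
by THEOREM L (i) at `60`) the Gram determinant of `(E_ζ′, i)` in the frame `θ^i` (`i < 8`) is `256`** (such `Φ`-positive `ζ′` exist on every `ℚ(i)`-balanced `Φ`, `exists_principal_sixty_sqrt_neg_one`): the SPLIT row for `ℚ(i)` at `g = 8` (census W8.1.1 `= (4, ℚ(i), 1)`);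
`(−1)⁴ det a > 0`, the right sign for Weil signature `(4,4)` [vG94 5.2 (4)].
research route conditional on HC_CM; not a corollary; Q11.4-sentence-2 already refuted in dim ≥ 3. [cite: vanGeemen1994HodgeAV, Lemma 5.2 (3)–(4) and (5.4.1)] [cite: Shimura1998, §14.3 Prop. 5, p. 104] -/
theorem det_realPart_principal_sqrtNegOne [IsCyclotomicExtension {60} ℚ K] [IsCMField K]
    (hζ : IsPrimitiveRoot ζ 60) {ζ' : K} (hζ' : IsCMField.complexConj K ζ' = -ζ')
    (hT : CMTypeLattice.IsOfType (1 : (FractionalIdeal (𝓞 K)⁰ K)ˣ) ζ' ⊤)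
    {x : Fin 8 → K} (hx : ∀ i, x i = (ζ + ζ⁻¹) ^ (i : ℕ)) {a : Matrix (Fin 8) (Fin 8) ℚ}
    (ha : ∀ i j, a i j = Algebra.trace ℚ K (ζ' * x i * IsCMField.complexConj K ((ζ ^ 15) * x j))) :
    a.det = 256 := by
  obtain ⟨ωb, hωb⟩ := exists_basis_thetaPow hζ
  have hx' : ∀ i, x i = (ωb i : K) := fun i => (hx i).trans (hωb i).symm
  rw [det_realPart_eq_of_isOfType ωb (complexConj_sqrtNegOne hζ) hx' (norm_realUnits_pos_sixty hζ)
    (complexConj_xi_sixty hζ) (xi_ne_zero hζ 7) hζ' (isOfType_one_xi_top hζ 7) hT (fun i j => rfl) ha]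
  exact det_realPart_xi_sqrtNegOne hζ hx (fun i j => rfl)

open scoped Classical in
/-- **CENSUS FORM** (the YES row `(60, ℚ(√−1))`: existence in the tree + the determinant here): for every CM type `Φ` of
`ℚ(ζ_60)` balanced for `N_K = {7, 11, 19, 23, 31, 43, 47, 59}`, `ℂ^Φ/Φ(ℤ[ζ_60])` carries a `Φ`-positive divisor of PRINCIPAL type, and EVERY
such divisor has van Geemen Gram determinant `256` in the real frame `θ^i`: the SPLIT row for `ℚ(i)` at `g = 8` (census W8.1.1 `= (4, ℚ(i), 1)`).
research route conditional on HC_CM; not a corollary; Q11.4-sentence-2 already refuted in dim ≥ 3. [cite: vanGeemen1994HodgeAV, Lemma 5.2 (3)–(4) and (5.4.1)] [cite: Shimura1998, §14.3 Prop. 4–5, pp. 103–104] -/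
theorem exists_principal_sqrtNegOne_det [IsCyclotomicExtension {60} ℚ K] [IsCMField K]
    (hζ : IsPrimitiveRoot ζ 60) (Φ : CMType K)
    (hbal : 2 * (SΦ[Φ, ζ] ∩ ({7, 11, 19, 23, 31, 43, 47, 59} : Finset (ZMod 60))).card = (SΦ[Φ, ζ]).card) :
    ∃ ζ' : K, IsCMField.complexConj K ζ' = -ζ' ∧ (∀ φ : Φ.1, 0 < (φ.1 ζ').im) ∧
      CMTypeLattice.IsOfType (1 : (FractionalIdeal (𝓞 K)⁰ K)ˣ) ζ' ⊤ ∧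
      ∀ (x : Fin 8 → K), (∀ i, x i = (ζ + ζ⁻¹) ^ (i : ℕ)) → ∀ a : Matrix (Fin 8) (Fin 8) ℚ,
        (∀ i j, a i j = Algebra.trace ℚ K (ζ' * x i * IsCMField.complexConj K ((ζ ^ 15) * x j))) →
        a.det = 256 := by
  obtain ⟨ζ', h1, h2, h3⟩ := exists_principal_sixty_sqrt_neg_one hζ Φ hbal
  exact ⟨ζ', h1, h2, h3, fun x hx a ha => det_realPart_principal_sqrtNegOne hζ h1 h3 hx ha⟩

/-! The CLASS of `256` in `ℚˣ/Nm(ℚ(i)ˣ)` — `splitDiscriminantClass 4 1`, SPLIT — is the SAME statement as at level `40`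
(`Summit.HodgeConjecture.Ring2WeilCoverage.WeilGramLevel40Principal.mk0_det_principal_sqrtNegOne`, this gen; not restated here): the principally polarised Weil-type
`ℤ[ζ₆₀]`-CM eightfolds for `ℚ(i)` lie on the SPLIT row for `ℚ(i)` at `g = 8` (census W8.1.1 `= (4, ℚ(i), 1)`). -/

/-! ### §4 `K_d = ℚ(√−3)` (`s = s₃`): invariance, census form, class SPLIT (row W8.3.1) -/

/-- **For EVERY skew `ζ′` of PRINCIPAL type on `ℤ[ζ_60]` (`IsOfType 1 ζ′ ⊤`; `ζ′ = uξ`, `u` a real unit, `N(u) = 1`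
by THEOREM L (i) at `60`) the Gram determinant of `(E_ζ′, s₃)` in the frame `θ^i` (`i < 8`) is `20736`** (such `Φ`-positive `ζ′` exist on every `ℚ(√−3)`-balanced `Φ`, `exists_principal_sixty_sqrt_neg_three`): the SPLIT row for `ℚ(√−3)` at `g = 8` (census W8.3.1 `= (4, ℚ(√−3), 1)`);
`(−1)⁴ det a > 0`, the right sign for Weil signature `(4,4)` [vG94 5.2 (4)].
research route conditional on HC_CM; not a corollary; Q11.4-sentence-2 already refuted in dim ≥ 3. [cite: vanGeemen1994HodgeAV, Lemma 5.2 (3)–(4) and (5.4.1)] [cite: Shimura1998, §14.3 Prop. 5, p. 104] -/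
theorem det_realPart_principal_sqrtNegThree [IsCyclotomicExtension {60} ℚ K] [IsCMField K]
    (hζ : IsPrimitiveRoot ζ 60) {ζ' : K} (hζ' : IsCMField.complexConj K ζ' = -ζ')
    (hT : CMTypeLattice.IsOfType (1 : (FractionalIdeal (𝓞 K)⁰ K)ˣ) ζ' ⊤)
    {x : Fin 8 → K} (hx : ∀ i, x i = (ζ + ζ⁻¹) ^ (i : ℕ)) {a : Matrix (Fin 8) (Fin 8) ℚ}
    (ha : ∀ i j, a i j = Algebra.trace ℚ K (ζ' * x i * IsCMField.complexConj K ((1 + 2 * ζ ^ 20) * x j))) :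
    a.det = 20736 := by
  obtain ⟨ωb, hωb⟩ := exists_basis_thetaPow hζ
  have hx' : ∀ i, x i = (ωb i : K) := fun i => (hx i).trans (hωb i).symm
  rw [det_realPart_eq_of_isOfType ωb (complexConj_sqrtNegThree hζ) hx' (norm_realUnits_pos_sixty hζ)
    (complexConj_xi_sixty hζ) (xi_ne_zero hζ 7) hζ' (isOfType_one_xi_top hζ 7) hT (fun i j => rfl) ha]
  exact det_realPart_xi_sqrtNegThree hζ hx (fun i j => rfl)

open scoped Classical in
/-- **CENSUS FORM** (the YES row `(60, ℚ(√−3))`: existence in the tree + the determinant here): for every CM type `Φ` of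
`ℚ(ζ_60)` balanced for `N_K = {11, 17, 23, 29, 41, 47, 53, 59}`, `ℂ^Φ/Φ(ℤ[ζ_60])` carries a `Φ`-positive divisor of PRINCIPAL type, and EVERY
such divisor has van Geemen Gram determinant `20736` in the real frame `θ^i`: the SPLIT row for `ℚ(√−3)` at `g = 8` (census W8.3.1 `= (4, ℚ(√−3), 1)`).
research route conditional on HC_CM; not a corollary; Q11.4-sentence-2 already refuted in dim ≥ 3. [cite: vanGeemen1994HodgeAV, Lemma 5.2 (3)–(4) and (5.4.1)] [cite: Shimura1998, §14.3 Prop. 4–5, pp. 103–104] -/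
theorem exists_principal_sqrtNegThree_det [IsCyclotomicExtension {60} ℚ K] [IsCMField K]
    (hζ : IsPrimitiveRoot ζ 60) (Φ : CMType K)
    (hbal : 2 * (SΦ[Φ, ζ] ∩ ({11, 17, 23, 29, 41, 47, 53, 59} : Finset (ZMod 60))).card = (SΦ[Φ, ζ]).card) :
    ∃ ζ' : K, IsCMField.complexConj K ζ' = -ζ' ∧ (∀ φ : Φ.1, 0 < (φ.1 ζ').im) ∧
      CMTypeLattice.IsOfType (1 : (FractionalIdeal (𝓞 K)⁰ K)ˣ) ζ' ⊤ ∧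
      ∀ (x : Fin 8 → K), (∀ i, x i = (ζ + ζ⁻¹) ^ (i : ℕ)) → ∀ a : Matrix (Fin 8) (Fin 8) ℚ,
        (∀ i j, a i j = Algebra.trace ℚ K (ζ' * x i * IsCMField.complexConj K ((1 + 2 * ζ ^ 20) * x j))) →
        a.det = 20736 := by
  obtain ⟨ζ', h1, h2, h3⟩ := exists_principal_sixty_sqrt_neg_three hζ Φ hbal
  exact ⟨ζ', h1, h2, h3, fun x hx a ha => det_realPart_principal_sqrtNegThree hζ h1 h3 hx ha⟩

/-! The CLASS of `20736` in `ℚˣ/Nm(ℚ(√−3)ˣ)` — `splitDiscriminantClass 4 3`, SPLIT — is the SAME statement as at level `48`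
(`Summit.HodgeConjecture.Ring2WeilCoverage.WeilGramLevel48Principal.mk0_det_principal_sqrtNegThree`, this gen; not restated here): the principally polarised Weil-type
`ℤ[ζ₆₀]`-CM eightfolds for `ℚ(√−3)` lie on the SPLIT row for `ℚ(√−3)` at `g = 8` (census W8.3.1 `= (4, ℚ(√−3), 1)`). -/

/-! ### §5 `K_d = ℚ(√−5)` (`s = s₅`): invariance, census form, class SPLIT (row W8.5.1) -/

/-- **For EVERY skew `ζ′` of PRINCIPAL type on `ℤ[ζ_60]` (`IsOfType 1 ζ′ ⊤`; `ζ′ = uξ`, `u` a real unit, `N(u) = 1`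
by THEOREM L (i) at `60`) the Gram determinant of `(E_ζ′, s₅)` in the frame `θ^i` (`i < 8`) is `160000`** (such `Φ`-positive `ζ′` exist on every `ℚ(√−5)`-balanced `Φ`, `exists_principal_sixty_sqrt_neg_five`): the SPLIT row for `ℚ(√−5)` at `g = 8` (census W8.5.1 `= (4, ℚ(√−5), 1)`);
`(−1)⁴ det a > 0`, the right sign for Weil signature `(4,4)` [vG94 5.2 (4)].
research route conditional on HC_CM; not a corollary; Q11.4-sentence-2 already refuted in dim ≥ 3. [cite: vanGeemen1994HodgeAV, Lemma 5.2 (3)–(4) and (5.4.1)] [cite: Shimura1998, §14.3 Prop. 5, p. 104] -/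
theorem det_realPart_principal_sqrtNegFive [IsCyclotomicExtension {60} ℚ K] [IsCMField K]
    (hζ : IsPrimitiveRoot ζ 60) {ζ' : K} (hζ' : IsCMField.complexConj K ζ' = -ζ')
    (hT : CMTypeLattice.IsOfType (1 : (FractionalIdeal (𝓞 K)⁰ K)ˣ) ζ' ⊤)
    {x : Fin 8 → K} (hx : ∀ i, x i = (ζ + ζ⁻¹) ^ (i : ℕ)) {a : Matrix (Fin 8) (Fin 8) ℚ}
    (ha : ∀ i j, a i j = Algebra.trace ℚ K (ζ' * x i * IsCMField.complexConj K ((ζ ^ 15 * (1 + 2 * (ζ ^ 12 + ζ ^ 48))) * x j))) :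
    a.det = 160000 := by
  obtain ⟨ωb, hωb⟩ := exists_basis_thetaPow hζ
  have hx' : ∀ i, x i = (ωb i : K) := fun i => (hx i).trans (hωb i).symm
  rw [det_realPart_eq_of_isOfType ωb (complexConj_sqrtNegFive hζ) hx' (norm_realUnits_pos_sixty hζ)
    (complexConj_xi_sixty hζ) (xi_ne_zero hζ 7) hζ' (isOfType_one_xi_top hζ 7) hT (fun i j => rfl) ha]
  exact det_realPart_xi_sqrtNegFive hζ hx (fun i j => rfl)

open scoped Classical in
/-- **CENSUS FORM** (the YES row `(60, ℚ(√−5))`: existence in the tree + the determinant here): for every CM type `Φ` of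
`ℚ(ζ_60)` balanced for `N_K = {11, 13, 17, 19, 31, 37, 53, 59}`, `ℂ^Φ/Φ(ℤ[ζ_60])` carries a `Φ`-positive divisor of PRINCIPAL type, and EVERY
such divisor has van Geemen Gram determinant `160000` in the real frame `θ^i`: the SPLIT row for `ℚ(√−5)` at `g = 8` (census W8.5.1 `= (4, ℚ(√−5), 1)`).
research route conditional on HC_CM; not a corollary; Q11.4-sentence-2 already refuted in dim ≥ 3. [cite: vanGeemen1994HodgeAV, Lemma 5.2 (3)–(4) and (5.4.1)] [cite: Shimura1998, §14.3 Prop. 4–5, pp. 103–104] -/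
theorem exists_principal_sqrtNegFive_det [IsCyclotomicExtension {60} ℚ K] [IsCMField K]
    (hζ : IsPrimitiveRoot ζ 60) (Φ : CMType K)
    (hbal : 2 * (SΦ[Φ, ζ] ∩ ({11, 13, 17, 19, 31, 37, 53, 59} : Finset (ZMod 60))).card = (SΦ[Φ, ζ]).card) :
    ∃ ζ' : K, IsCMField.complexConj K ζ' = -ζ' ∧ (∀ φ : Φ.1, 0 < (φ.1 ζ').im) ∧
      CMTypeLattice.IsOfType (1 : (FractionalIdeal (𝓞 K)⁰ K)ˣ) ζ' ⊤ ∧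
      ∀ (x : Fin 8 → K), (∀ i, x i = (ζ + ζ⁻¹) ^ (i : ℕ)) → ∀ a : Matrix (Fin 8) (Fin 8) ℚ,
        (∀ i j, a i j = Algebra.trace ℚ K (ζ' * x i * IsCMField.complexConj K ((ζ ^ 15 * (1 + 2 * (ζ ^ 12 + ζ ^ 48))) * x j))) →
        a.det = 160000 := by
  obtain ⟨ζ', h1, h2, h3⟩ := exists_principal_sixty_sqrt_neg_five hζ Φ hbal
  exact ⟨ζ', h1, h2, h3, fun x hx a ha => det_realPart_principal_sqrtNegFive hζ h1 h3 hx ha⟩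

/-! The CLASS of `160000` in `ℚˣ/Nm(ℚ(√−5)ˣ)` — `splitDiscriminantClass 4 5`, SPLIT — is the SAME statement as at level `40`
(`Summit.HodgeConjecture.Ring2WeilCoverage.WeilGramLevel40Principal.mk0_det_principal_sqrtNegFive`, this gen; not restated here): the principally polarised Weil-type
`ℤ[ζ₆₀]`-CM eightfolds for `ℚ(√−5)` lie on the SPLIT row for `ℚ(√−5)` at `g = 8` (census W8.5.1 `= (4, ℚ(√−5), 1)`). -/

/-! ### §6 `K_d = ℚ(√−15)` (`s = s₁₅`): invariance, census form, class SPLIT (row W8.15.1) -/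

/-- **For EVERY skew `ζ′` of PRINCIPAL type on `ℤ[ζ_60]` (`IsOfType 1 ζ′ ⊤`; `ζ′ = uξ`, `u` a real unit, `N(u) = 1`
by THEOREM L (i) at `60`) the Gram determinant of `(E_ζ′, s₁₅)` in the frame `θ^i` (`i < 8`) is `12960000`** (such `Φ`-positive `ζ′` exist on every `ℚ(√−15)`-balanced `Φ`, `exists_principal_sixty_sqrt_neg_fifteen`): the SPLIT row for `ℚ(√−15)` at `g = 8` (census W8.15.1 `= (4, ℚ(√−15), 1)`);
`(−1)⁴ det a > 0`, the right sign for Weil signature `(4,4)` [vG94 5.2 (4)].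
research route conditional on HC_CM; not a corollary; Q11.4-sentence-2 already refuted in dim ≥ 3. [cite: vanGeemen1994HodgeAV, Lemma 5.2 (3)–(4) and (5.4.1)] [cite: Shimura1998, §14.3 Prop. 5, p. 104] -/
theorem det_realPart_principal_sqrtNegFifteen [IsCyclotomicExtension {60} ℚ K] [IsCMField K]
    (hζ : IsPrimitiveRoot ζ 60) {ζ' : K} (hζ' : IsCMField.complexConj K ζ' = -ζ')
    (hT : CMTypeLattice.IsOfType (1 : (FractionalIdeal (𝓞 K)⁰ K)ˣ) ζ' ⊤)
    {x : Fin 8 → K} (hx : ∀ i, x i = (ζ + ζ⁻¹) ^ (i : ℕ)) {a : Matrix (Fin 8) (Fin 8) ℚ}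
    (ha : ∀ i j, a i j = Algebra.trace ℚ K (ζ' * x i * IsCMField.complexConj K (((1 + 2 * ζ ^ 20) * (1 + 2 * (ζ ^ 12 + ζ ^ 48))) * x j))) :
    a.det = 12960000 := by
  obtain ⟨ωb, hωb⟩ := exists_basis_thetaPow hζ
  have hx' : ∀ i, x i = (ωb i : K) := fun i => (hx i).trans (hωb i).symm
  rw [det_realPart_eq_of_isOfType ωb (complexConj_sqrtNegFifteen hζ) hx' (norm_realUnits_pos_sixty hζ)
    (complexConj_xi_sixty hζ) (xi_ne_zero hζ 7) hζ' (isOfType_one_xi_top hζ 7) hT (fun i j => rfl) ha]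
  exact det_realPart_xi_sqrtNegFifteen hζ hx (fun i j => rfl)

open scoped Classical in
/-- **CENSUS FORM** (the YES row `(60, ℚ(√−15))`: existence in the tree + the determinant here): for every CM type `Φ` of
`ℚ(ζ_60)` balanced for `N_K = {7, 11, 13, 29, 37, 41, 43, 59}`, `ℂ^Φ/Φ(ℤ[ζ_60])` carries a `Φ`-positive divisor of PRINCIPAL type, and EVERY
such divisor has van Geemen Gram determinant `12960000` in the real frame `θ^i`: the SPLIT row for `ℚ(√−15)` at `g = 8` (census W8.15.1 `= (4, ℚ(√−15), 1)`).
research route conditional on HC_CM; not a corollary; Q11.4-sentence-2 already refuted in dim ≥ 3. [cite: vanGeemen1994HodgeAV, Lemma 5.2 (3)–(4) and (5.4.1)] [cite: Shimura1998, §14.3 Prop. 4–5, pp. 103–104] -/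
theorem exists_principal_sqrtNegFifteen_det [IsCyclotomicExtension {60} ℚ K] [IsCMField K]
    (hζ : IsPrimitiveRoot ζ 60) (Φ : CMType K)
    (hbal : 2 * (SΦ[Φ, ζ] ∩ ({7, 11, 13, 29, 37, 41, 43, 59} : Finset (ZMod 60))).card = (SΦ[Φ, ζ]).card) :
    ∃ ζ' : K, IsCMField.complexConj K ζ' = -ζ' ∧ (∀ φ : Φ.1, 0 < (φ.1 ζ').im) ∧
      CMTypeLattice.IsOfType (1 : (FractionalIdeal (𝓞 K)⁰ K)ˣ) ζ' ⊤ ∧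
      ∀ (x : Fin 8 → K), (∀ i, x i = (ζ + ζ⁻¹) ^ (i : ℕ)) → ∀ a : Matrix (Fin 8) (Fin 8) ℚ,
        (∀ i j, a i j = Algebra.trace ℚ K (ζ' * x i * IsCMField.complexConj K (((1 + 2 * ζ ^ 20) * (1 + 2 * (ζ ^ 12 + ζ ^ 48))) * x j))) →
        a.det = 12960000 := by
  obtain ⟨ζ', h1, h2, h3⟩ := exists_principal_sixty_sqrt_neg_fifteen hζ Φ hbal
  exact ⟨ζ', h1, h2, h3, fun x hx a ha => det_realPart_principal_sqrtNegFifteen hζ h1 h3 hx ha⟩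

/-- **`[12960000]` is the SPLIT class `splitDiscriminantClass 4 15` in `ℚˣ/Nm(ℚ(√−15)ˣ)`** (`12960000 = 3600² + 15·0² ∈ Nm`; `n = 4` even):
the principally polarised Weil-type `ℤ[ζ₆₀]`-CM eightfolds for `ℚ(√−15)` lie on the SPLIT row for `ℚ(√−15)` at `g = 8` (census W8.15.1 `= (4, ℚ(√−15), 1)`) — b02.1 (F3) / b01.8 for these CM points, in the kernel.
research route conditional on HC_CM; not a corollary; Q11.4-sentence-2 already refuted in dim ≥ 3. [cite: vanGeemen1994HodgeAV, 5.4 and (5.4.1)] -/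
theorem mk0_det_principal_sqrtNegFifteen :
    (QuotientGroup.mk (Units.mk0 (12960000 : ℚ) (by norm_num)) : weilNormResidueGroup 15) = splitDiscriminantClass 4 15 :=
  mk_eq_split_of_even (by decide) (by norm_num : (12960000 : ℚ) ≠ 0)
    (mem_normUnitsSubgroup_of_sq_add_mul_sq _ (3600 : ℚ) (0 : ℚ) (by norm_num))

end Summit.HodgeConjecture.Ring2WeilCoverage.WeilGramLevel60Principal

end
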